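import Literature.AlgebraicGeometry.GroupSchemes.BarsottiTateGroup
import HarnessLib

/-!
# Homomorphisms of Barsotti–Tate groups; the induced homomorphism `f[p^∞]` for kernel presentations `B = Ker[p^·]_M`

Topic `Literature/AlgebraicGeometry/GroupSchemes`; namespace `Literature.AlgebraicGeometry.GroupSchemes.BTGroup`.  Cell
`hodgecm-mathlib` (D-0151), FLOOR 0, P6 «MOD programme» generic organ G3 of the P6b desk census (F0P6b-plan (g0),
`CENSUS-P6b-Row4.v0` §(iv): «`GroupSchemes/BarsottiTateGroupHom.lean` — homomorphisms of BT groups layerwise … `f[p^∞]` of a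
homomorphism of abelian schemes; needed by L4B1ff» = Serre–Tate full faithfulness); sibling of ★ `BarsottiTateGroup` (carrier +
socket), ★ `BarsottiTateGroupBaseChange`, ★ `AbelianSchemes/PDivisibleGroupOfAbelianScheme`.  `--supports stmt-HodgeConjecture-24832`;
COUNT-NEUTRAL: HC_CM is proved only modulo the 7 printed citations until rung 0 closes; this file discharges none of them.
One `structure` (`BTGroup.Hom`), two plumbing `def`s (`Hom.id`, `Hom.comp`), theorems; no named fact, no instance, no notation.

THE PRINT.  [Tate1967] §2 (2.1)–(2.2): `p`-divisible groups form a category (morphisms of inductive systems by homomorphisms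
of group schemes) and `A ↦ A(p) = A[p^∞]` is a functor from abelian schemes; [Messing1972] Ch. I (1.1)–(1.6).  The functor on
MORPHISMS is what Serre–Tate's full faithfulness ([Katz1981] Thm. 1.2.1; MOD-PLAN L4B.1) is a statement about.

WHAT IS HERE:
* §1 **`BTGroup.Hom B B'`** (`app n : B.G n ⟶ B'.G n` homomorphisms over `S` with `incl n ≫ app (n+1) = app n ≫ incl n`;
  heights may differ), `Hom.ext`, `Hom.id`, `Hom.comp`, `id_comp ∕ comp_id ∕ comp_assoc`, `mono_incl`, and the DERIVED
  compatibilities **`pMap_comp_app : pMap n ≫ app n = app (n+1) ≫ pMap n`** (via the monomorphism `incl` and `pMap_incl`)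
  and `pow_id_comp_app`;
* §2 for KERNEL PRESENTATIONS — homomorphisms `i n : B.G n ⟶ M` into an `S`-group scheme making `B.G n` the kernel of
  `[p^n]_M` (cartesian square against the unit section), compatibly with `incl`: exactly the data of the socket
  `BTGroup.IsOfAbelianScheme` — `mono_of_isPullback_unit` and **`existsUnique_hom_of_kernelPresentation`**: a homomorphism
  `f : M ⟶ M'` induces a UNIQUE `F : Hom B B'` with `F.app n ≫ i' n = i n ≫ f` («`f[p^∞]`»; lift through the kernel square of
  `B'.G n`, homomorphism and `incl`-compatibility tested after the monomorphism `i' n`).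

NOT HERE: isogenies ∕ kernels of homomorphisms of BT groups, the abelian-scheme instance `A ↦ A.pDivisibleGroup` as a functor
(sibling `AbelianSchemes/PDivisibleGroupFunctor.lean`), exactness properties.

## References
* [Tate1967] J. T. Tate, *p-divisible groups*, Proc. Conf. Local Fields (Driebergen 1966), Springer 1967 — §2 (2.1)–(2.2).
* [Messing1972] W. Messing, *The Crystals Associated to Barsotti–Tate Groups*, LNM 264 (1972) — Ch. I (1.1)–(1.6).
-/

noncomputable section

universe u

open CategoryTheory CategoryTheory.Limits AlgebraicGeometry MonoidalCategory CartesianMonoidalCategory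
open scoped MonObj

namespace Literature.AlgebraicGeometry.GroupSchemes

namespace BTGroup

variable {S : Scheme.{u}} {p h h' h'' : ℕ}

/-! ## §1 Homomorphisms -/

/-- **A HOMOMORPHISM OF BARSOTTI–TATE GROUPS `B → B'` over `S`** (Tate: a morphism of the inductive systems by homomorphisms
of group schemes): `S`-group-scheme homomorphisms `app n : B.G n ⟶ B'.G n` compatible with the transitions `incl`
(compatibility with the `[p]`-maps `pMap` FOLLOWS, `pMap_comp_app`).  Heights may differ. [cite: Tate1967, §2 (2.1)] -/
structure Hom (B : BTGroup S p h) (B' : BTGroup S p h') where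
  /-- the layer maps `B.G n ⟶ B'.G n` over `S` -/
  app : ∀ n, B.G n ⟶ B'.G n
  /-- … homomorphisms for the layers' group laws … -/
  isMonHom_app : ∀ n, letI := B.grpObj n; letI := B'.grpObj n; IsMonHom (app n)
  /-- … compatible with the transitions: `incl n ≫ app (n+1) = app n ≫ incl n`. -/
  incl_comp_app : ∀ n, B.incl n ≫ app (n + 1) = app n ≫ B'.incl n

attribute [reassoc] Hom.incl_comp_app

/-- The transitions `incl n` of a Barsotti–Tate group are monomorphisms of `S`-schemes (closed immersions on underlying
schemes; the forgetful functor reflects monomorphisms). [cite: Tate1967, §2 (2.1)] -/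
theorem mono_incl (B : BTGroup S p h) (n : ℕ) : Mono (B.incl n) := by
  haveI := B.isClosedImmersion_incl n
  exact Over.mono_of_mono_left _

namespace Hom

variable {B : BTGroup S p h} {B' : BTGroup S p h'} {B'' : BTGroup S p h''}

/-- Two homomorphisms with the same layer maps are equal. [cite: Tate1967, §2 (2.1)] -/
@[ext]
theorem ext {F G : Hom B B'} (hFG : ∀ n, F.app n = G.app n) : F = G := by
  cases F; cases G; congr; exact funext hFG

variable (B) in
/-- The identity homomorphism. [cite: Tate1967, §2 (2.1)] -/
def id : Hom B B where
  app n := 𝟙 (B.G n)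
  isMonHom_app n := by letI := B.grpObj n; infer_instance
  incl_comp_app n := by rw [Category.comp_id, Category.id_comp]

/-- Composition of homomorphisms. [cite: Tate1967, §2 (2.1)] -/
def comp (F : Hom B B') (G : Hom B' B'') : Hom B B'' where
  app n := F.app n ≫ G.app n
  isMonHom_app n := by
    letI := B.grpObj n; letI := B'.grpObj n; letI := B''.grpObj n
    haveI := F.isMonHom_app n; haveI := G.isMonHom_app n
    infer_instance
  incl_comp_app n := by rw [F.incl_comp_app_assoc, G.incl_comp_app, Category.assoc]

/-- Unfolding. [cite: Tate1967, §2 (2.1)] -/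
@[simp] theorem id_app (n : ℕ) : (Hom.id B).app n = 𝟙 (B.G n) := rfl

/-- Unfolding. [cite: Tate1967, §2 (2.1)] -/
@[simp] theorem comp_app (F : Hom B B') (G : Hom B' B'') (n : ℕ) : (F.comp G).app n = F.app n ≫ G.app n := rfl

/-- `id ≫ F = F`. [cite: Tate1967, §2 (2.1)] -/
@[simp] theorem id_comp (F : Hom B B') : (Hom.id B).comp F = F := by ext n; simp

/-- `F ≫ id = F`. [cite: Tate1967, §2 (2.1)] -/
@[simp] theorem comp_id (F : Hom B B') : F.comp (Hom.id B') = F := by ext n; simp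

/-- Associativity of composition. [cite: Tate1967, §2 (2.1)] -/
theorem comp_assoc {h''' : ℕ} {B''' : BTGroup S p h'''} (F : Hom B B') (G : Hom B' B'') (H : Hom B'' B''') :
    (F.comp G).comp H = F.comp (G.comp H) := by ext n; simp

/-- **Homomorphisms commute with the `[p]`-maps**: `pMap n ≫ app n = app (n+1) ≫ pMap n` (compose with the monomorphism
`incl n` and use `pMap_incl : pMap ≫ incl = [p]`, preserved by the homomorphism `app (n+1)`). [cite: Tate1967, §2 (2.1)] -/
@[reassoc]
theorem pMap_comp_app (F : Hom B B') (n : ℕ) : B.pMap n ≫ F.app n = F.app (n + 1) ≫ B'.pMap n := by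
  letI := B.grpObj (n + 1); letI := B'.grpObj (n + 1)
  haveI := F.isMonHom_app (n + 1)
  haveI := mono_incl B' n
  rw [← cancel_mono (B'.incl n), Category.assoc, Category.assoc, ← F.incl_comp_app, ← Category.assoc, B.pMap_incl n,
    B'.pMap_incl n, MonObj.pow_comp, Category.id_comp, MonObj.comp_pow, Category.comp_id]

/-- Homomorphisms commute with multiplication by any `N` on the layers. [cite: Tate1967, §2 (2.1)] -/
theorem pow_id_comp_app (F : Hom B B') (n N : ℕ) :
    (letI := B.grpObj n; (𝟙 (B.G n)) ^ N) ≫ F.app n = F.app n ≫ (letI := B'.grpObj n; (𝟙 (B'.G n)) ^ N) := by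
  letI := B.grpObj n; letI := B'.grpObj n
  haveI := F.isMonHom_app n
  rw [MonObj.pow_comp, Category.id_comp, MonObj.comp_pow, Category.comp_id]

end Hom

/-! ## §2 `f[p^∞]`: a homomorphism of the ambient group schemes induces a unique homomorphism of kernel presentations -/

section KernelPresentation

variable {M M' : Over S} [GrpObj M] [GrpObj M'] {B : BTGroup S p h} {B' : BTGroup S p h'}

/-- In a kernel presentation `B.G n →(i n) M` (cartesian square against the unit section, as in the socket
`IsOfAbelianScheme`), the maps `i n` are monomorphisms. [cite: Tate1967, §2 (2.1)] -/
theorem mono_of_isPullback_unit {n : ℕ} {i : B.G n ⟶ M} {e : M ⟶ M}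
    (hsq : IsPullback i (toUnit (B.G n)) e η[M]) : Mono i := by
  haveI : IsSplitMono (η[M] : 𝟙_ (Over S) ⟶ M) := IsSplitMono.mk' ⟨toUnit M, toUnit_unique _ _⟩
  exact hsq.mono_fst_of_mono

/-- **THE INDUCED HOMOMORPHISM `f[p^∞]`, EXISTENCE AND UNIQUENESS**: let `B`, `B'` be Barsotti–Tate groups presented as
kernels in `S`-group schemes `M`, `M'` — homomorphisms `i n : B.G n ⟶ M`, `i' n : B'.G n ⟶ M'` making `B.G n` the kernel of
`[p^n]_M` and `B'.G n` that of `[p^n]_{M'}` (cartesian squares against the unit sections), compatibly with the transitions —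
and let `f : M ⟶ M'` be a homomorphism.  Then there is a UNIQUE homomorphism of Barsotti–Tate groups `F : B → B'` with
`F.app n ≫ i' n = i n ≫ f` for all `n` (Tate: `A ↦ A[p^∞]` is a functor; the shape Serre–Tate's full faithfulness speaks).
[cite: Tate1967, §2 (2.1)] -/
theorem existsUnique_hom_of_kernelPresentation
    (i : ∀ n, B.G n ⟶ M) (hi : ∀ n, letI := B.grpObj n; IsMonHom (i n))
    (hsq : ∀ n, IsPullback (i n) (toUnit (B.G n)) (((𝟙 M : M ⟶ M) ^ (p ^ n) : M ⟶ M)) η[M])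
    (hcomp : ∀ n, B.incl n ≫ i (n + 1) = i n)
    (i' : ∀ n, B'.G n ⟶ M') (hi' : ∀ n, letI := B'.grpObj n; IsMonHom (i' n))
    (hsq' : ∀ n, IsPullback (i' n) (toUnit (B'.G n)) (((𝟙 M' : M' ⟶ M') ^ (p ^ n) : M' ⟶ M')) η[M'])
    (hcomp' : ∀ n, B'.incl n ≫ i' (n + 1) = i' n)
    (f : M ⟶ M') [IsMonHom f] :
    ∃! F : Hom B B', ∀ n, F.app n ≫ i' n = i n ≫ f := by
  -- the layer maps: lift `i n ≫ f` through the kernel square of `B'.G n`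
  have hw : ∀ n, (i n ≫ f) ≫ ((𝟙 M' : M' ⟶ M') ^ (p ^ n)) = toUnit (B.G n) ≫ η[M'] := fun n => by
    have hf : f ^ (p ^ n) = ((𝟙 M : M ⟶ M) ^ (p ^ n)) ≫ f := by rw [MonObj.pow_comp, Category.id_comp]
    rw [Category.assoc, MonObj.comp_pow, Category.comp_id, hf, ← Category.assoc, (hsq n).w, Category.assoc,
      IsMonHom.one_hom]
  let L : ∀ n, B.G n ⟶ B'.G n := fun n => (hsq' n).lift (i n ≫ f) (toUnit (B.G n)) (hw n)
  have hL : ∀ n, L n ≫ i' n = i n ≫ f := fun n => (hsq' n).lift_fst _ _ _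
  haveI : ∀ n, Mono (i' n) := fun n => mono_of_isPullback_unit (hsq' n)
  refine ⟨⟨L, fun n => ?_, fun n => ?_⟩, hL, fun G hG => Hom.ext fun n => ?_⟩
  · -- homomorphism: test after the monomorphism `i' n`
    letI := B.grpObj n; letI := B'.grpObj n
    haveI := hi n; haveI := hi' n
    refine ⟨?_, ?_⟩
    · rw [← cancel_mono (i' n), Category.assoc, hL, ← Category.assoc, IsMonHom.one_hom, IsMonHom.one_hom,
        IsMonHom.one_hom]
    · rw [← cancel_mono (i' n), Category.assoc, hL, ← Category.assoc, IsMonHom.mul_hom, Category.assoc,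
        IsMonHom.mul_hom, ← Category.assoc, tensorHom_comp_tensorHom, Category.assoc, IsMonHom.mul_hom,
        ← Category.assoc, tensorHom_comp_tensorHom, hL]
  · rw [← cancel_mono (i' (n + 1)), Category.assoc, hL, ← Category.assoc, hcomp, Category.assoc, hcomp', hL]
  · rw [← cancel_mono (i' n), hG n, hL]

end KernelPresentation

end BTGroup

end Literature.AlgebraicGeometry.GroupSchemes

end
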